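import Summits.HodgeConjecture.HodgeConjecture.Theses.RankFourFaces
import Summits.HodgeConjecture.HodgeConjecture.Theorems.PadicSemiregularLiftHodgeBeyondAnchorsMotivatedSplit
import Literature.AlgebraicGeometry.Motives.AbelianVarietyProjectiveChart

/-!
# [Cruxes workfile] `RankFourFaces.AbelianComplement` (stmt-HodgeConjecture-15889, ex stmt-10452): the two BC2-redirect
decompositions of the route's summit-equivalent remainder — sorry-free glue

Route `RankFourFaces` of `HodgeConjecture`. Its last crux `AbelianComplement` (the Hodge conjecture for every
smooth projective complex `n`-fold that is not `A.X` for an abelian variety `A` with `A.dim = n`) is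
kernel-checked EQUIVALENT to the summit with NO residual hypothesis
(`Theorems/AbelianComplement/Negative/RankFourFacesSummitEquivalence.lean`,
`abelianComplement_iff_hodgeConjecture`); so under the "restated is a redirect" rule the node must carry its
own decomposition. Two typed decompositions, each with its glue proved here from tree theorems only
(this is the crux-strategist's WORKFILE under `Cruxes/AbelianComplement/`, namespace `…Cruxes.AbelianComplement.SplitGlue`;
the prover's Theorems copy `Theorems/RankFourFacesAbelianComplementSplit.lean` should use namespace
`…Theorems.AbelianComplement` and the same declaration names):

* **(I) ABELIAN DOMINATION** (primary; it makes the route's own chain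
  `RankFourWeilTransport → FaceReduction → CMToAbelian ⇒ HC(abelian varieties)` load-bearing for the summit):
  `AbelianComplement ⟸ HodgeAbelianVarieties ∧ AbelianDomination ∧ DiagonalPullbackAlgebraic`, where
  - `HodgeAbelianVarieties` — HC for every complex abelian variety (verbatim the shared item stmt-HodgeConjecture-1333,
    `PadicSemiregularLift.HodgeAbelianVarieties`; in this route it is the OUTPUT of the chain, `h₄ (h₃ h₂)`);
  - `AbelianDomination` — NEW: every rational `(p,p)`-class in the deep middle `2 ≤ p ≤ n/2` of a smooth projective
    complex `n`-fold `X` is the image `T c'` of a rational `(q,q)`-class `c'` on (the underlying variety of) some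
    complex abelian variety `A` under a linear map `T : H^{2q}(A(ℂ);ℂ) → H^{2p}(X(ℂ);ℂ)` INDUCED BY AN ALGEBRAIC
    CORRESPONDENCE (`HodgeTheory.IsAlgebraicCorrespondence`, André 1996 §2.1 / Kleiman on the real carriers) —
    "Hodge classes are dominated by abelian Hodge classes"; a consequence of HC (take `Γ = Z × {a}`), a theorem for
    abelian `X` (identity, `abelianDomination_of_abelianVariety` below), for varieties dominated by products of
    curves (Fermat hypersurfaces: Shioda–Katsura + Albanese) and wherever the Kuga–Satake correspondence is known
    algebraic; open in general exactly where HC is open off abelian type;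
  - `DiagonalPullbackAlgebraic` — pull-back along the diagonal preserves `Nᵖ H²ᵖ` (verbatim the shared support item
    stmt-HodgeConjecture-17490; Voisin II Prop. 9.21 (i), a theorem in print; the tree's standing intersection-theory
    debt `≃ Voisin2003_cupProduct_algebraicClasses`).
  Glue: `hodgeConjecture_of_hodgeAbelianVarieties_of_abelianDomination` (the deep-middle class `c = T c'` is algebraic
  because `c'` is (HC on `A`) and algebraic correspondences preserve algebraic classes granted Prop. 9.20,
  `corrClassAction_mem_algebraicClasses_of_cupProduct`; the other codimensions by Lefschetz `(1,1)` / hard Lefschetz,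
  `cyclePart_of_deepMiddle`; Hodge models by `nonempty_hodgeModel_holds`) and its restriction
  `abelianComplement_of_subs`.
* **(II) ANDRÉ'S MOTIVATED SPLIT** (alternative; the door already prepared on the sibling remainders
  `PadicSemiregularLift.HodgeBeyondAnchors`, `HeckePrymWeil.SummitOffWeilSector`):
  `AbelianComplement ⟸ HodgeClassesMotivated (stmt-17488) ∧ LefschetzStandardB (stmt-17489) ∧ DiagonalPullbackAlgebraic (stmt-17490)`,
  glue `abelianComplement_of_motivated_of_standardConjectureB` = the landed
  `HodgeBeyondAnchors.hodgeConjecture_of_motivated_of_standardConjectureB` restricted to the non-abelian locus.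

Consistency directions recorded: `hodgeAbelianVarieties_of_hodgeConjecture` (S ⇒ child 1),
`abelianDomination_of_abelianVariety` (child 2 holds on abelian varieties: its content is off-abelian, i.e. it is the
honest typed form of "the complement"). Nothing here claims `AbelianDomination`, `HodgeAbelianVarieties`, HM or B.

References: Y. André, *Pour une théorie inconditionnelle des motifs*, Publ. Math. IHÉS 83 (1996), §0.3, §2.1 Déf. 1,
Thm 0.6.2; S. Kleiman, *Algebraic cycles and the Weil conjectures* (1968) §1; C. Voisin, *Hodge Theory and Complex
Algebraic Geometry II* (2003), §9.2.4 Prop. 9.20–9.21; C. Schoen, *Varieties dominated by product varieties*,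
Internat. J. Math. 7 (1996) 541–571; T. Shioda, T. Katsura, *On Fermat varieties*, Tôhoku Math. J. 31 (1979) 97–115;
P. Deligne, *The Hodge conjecture* (Clay, 2000), §1.
-/

set_option linter.dupNamespace false

noncomputable section

open CategoryTheory AlgebraicGeometry MonoidalCategory CartesianMonoidalCategory
open Literature.AlgebraicTopology.SingularHomology Literature.Geometry.Kaehler
open Literature.AlgebraicGeometry.Motives Literature.AlgebraicGeometry.HodgeTheory

namespace Summit.HodgeConjecture.HodgeConjecture.Cruxes.AbelianComplement.SplitGlue

open Summit.HodgeConjecture.HodgeConjecture.Theorems.HodgeBeyondAnchors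

/-! ## (I) Abelian domination: `HC_AV → AbDom → Δ → HodgeConjecture` -/

/-- **The Hodge conjecture from HC for abelian varieties plus abelian domination of Hodge classes**
(sorry-free glue, tree theorems only). If (1) HC holds for every complex abelian variety, (2) every rational
`(p,p)`-class in the deep middle of every smooth projective complex variety is the image of a rational
`(q,q)`-class on an abelian variety under a map induced by an algebraic correspondence, and (3) diagonal
pull-back preserves `Nᵖ H²ᵖ`, then `HodgeConjecture`: Hodge models exist (`nonempty_hodgeModel_holds`); the
cycle clause reduces to the deep middle (`cyclePart_of_deepMiddle` with the discharged Lefschetz `(1,1)` and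
hard Lefschetz); there `c = T c' = γ^*(c')` with `γ` algebraic on `X × A` and `c'` algebraic on `A` by (1), so
`c` is algebraic by Voisin II Prop. 9.21 granted Prop. 9.20 (`corrClassAction_mem_algebraicClasses_of_cupProduct`,
the multiplicativity coming from (3) by `cupProduct_mem_algebraicClasses_of_forall_map_diagonal`).
[cite: VoisinHodgeII2003, §9.2.4 Prop. 9.20 and Prop. 9.21] [cite: Andre1996Motifs, §2.1 (p. 14)] -/
theorem hodgeConjecture_of_hodgeAbelianVarieties_of_abelianDomination
    (hAV : ∀ A : AbelianVariety ℂ, HodgeConjectureFor A.dim A.X)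
    (hDom : ∀ ⦃n : ℕ⦄ ⦃X : SchemeOver ℂ⦄, IsSmoothProjective n X →
      ∀ p : ℕ, 2 ≤ p → 2 * p ≤ n →
        ∀ c : complexBetti X (2 * p), IsRationalClass c → IsOfHodgeType n X (2 * p) p p c →
          ∃ (A : AbelianVariety ℂ) (q : ℕ) (c' : complexBetti A.X (2 * q))
            (T : complexBetti A.X (2 * q) →ₗ[ℂ] complexBetti X (2 * p)),
            IsRationalClass c' ∧ IsOfHodgeType A.dim A.X (2 * q) q q c' ∧
              IsAlgebraicCorrespondence n A.dim X A.X T ∧ T c' = c)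
    (hΔ : ∀ ⦃d : ℕ⦄ ⦃V : SchemeOver ℂ⦄, IsSmoothProjective d V → ∀ (p : ℕ)
      ⦃c : complexBetti (V ⊗ V) (2 * p)⦄, c ∈ algebraicClasses (V ⊗ V) p →
        complexBetti.map (lift (𝟙 V) (𝟙 V)) (2 * p) c ∈ algebraicClasses V p) :
    _root_.HodgeConjecture := by
  intro n X hX
  refine ⟨nonempty_hodgeModel_holds hX, ?_⟩
  refine cyclePart_of_deepMiddle lefschetzOneOne_rational_holds
    (nonempty_hardLefschetzNFold_holds n X) hX ?_
  intro p hp2 hpn c hc hpp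
  obtain ⟨A, q, c', T, hc', hpp', ⟨μ, ν, hμ, hν, e, k, hab, hk, γ, hγ, hT⟩, hTc⟩ :=
    hDom hX p hp2 hpn c hc hpp
  have hA : IsSmoothProjective A.dim A.X := AbelianVariety.isSmoothProjective_holds
  have halg : c' ∈ algebraicClasses A.X q := (hAV A).2 q c' hc' hpp'
  rw [← hTc, ← hT]
  exact corrClassAction_mem_algebraicClasses_of_cupProduct hX hA μ ν hν hab hk
    (fun x y hx hy ↦ cupProduct_mem_algebraicClasses_of_forall_map_diagonal hΔ
      (IsSmoothProjective.tensor_holds hX hA) _ _ hx hy) hγ halg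

/-- **Glue of the primary split** — the `--glue` declaration of
`route edit --split AbelianComplement --into {HodgeAbelianVarieties, AbelianDomination, DiagonalPullbackAlgebraic}`:
`HC_AV → AbDom → Δ → RankFourFaces.AbelianComplement`, by restricting the glued summit to the non-abelian locus
(the abelian exclusion is not load-bearing, `abelianComplement_iff_without_exclusion`). The three antecedents are
verbatim the children's statements. [cite: Andre1996Motifs, §2.1 (p. 14)] [cite: Deligne2000, §1] -/
theorem abelianComplement_of_subs :
    (∀ A : AbelianVariety ℂ, HodgeConjectureFor A.dim A.X) →
    (∀ ⦃n : ℕ⦄ ⦃X : SchemeOver ℂ⦄, IsSmoothProjective n X →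
      ∀ p : ℕ, 2 ≤ p → 2 * p ≤ n →
        ∀ c : complexBetti X (2 * p), IsRationalClass c → IsOfHodgeType n X (2 * p) p p c →
          ∃ (A : AbelianVariety ℂ) (q : ℕ) (c' : complexBetti A.X (2 * q))
            (T : complexBetti A.X (2 * q) →ₗ[ℂ] complexBetti X (2 * p)),
            IsRationalClass c' ∧ IsOfHodgeType A.dim A.X (2 * q) q q c' ∧
              IsAlgebraicCorrespondence n A.dim X A.X T ∧ T c' = c) →
    (∀ ⦃d : ℕ⦄ ⦃V : SchemeOver ℂ⦄, IsSmoothProjective d V → ∀ (p : ℕ)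
      ⦃c : complexBetti (V ⊗ V) (2 * p)⦄, c ∈ algebraicClasses (V ⊗ V) p →
        complexBetti.map (lift (𝟙 V) (𝟙 V)) (2 * p) c ∈ algebraicClasses V p) →
    Summit.HodgeConjecture.HodgeConjecture.Theses.RankFourFaces.AbelianComplement :=
  fun hAV hDom hΔ _ _ hX _ ↦ hodgeConjecture_of_hodgeAbelianVarieties_of_abelianDomination hAV hDom hΔ hX

/-! ## (II) André's motivated split: `HM → B → Δ → AbelianComplement` -/

/-- **Glue of the alternative (André) split** — `--glue` declaration of
`route edit --split AbelianComplement --into {HodgeClassesMotivated, LefschetzStandardB, DiagonalPullbackAlgebraic}`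
(children verbatim stmt-HodgeConjecture-17488 / 17489 / 17490 of route `MotivatedLefschetzSplit`): the landed
`HodgeBeyondAnchors.hodgeConjecture_of_motivated_of_standardConjectureB` restricted to the non-abelian locus.
[cite: Andre1996Motifs, §0.3 (pp. 7–8) and §2.1 Déf. 1 (p. 14)] -/
theorem abelianComplement_of_motivated_of_standardConjectureB :
    (∀ ⦃n : ℕ⦄ ⦃X : SchemeOver ℂ⦄, IsSmoothProjective n X →
      ∀ p : ℕ, 2 ≤ p → 2 * p ≤ n →
        ∀ c : complexBetti X (2 * p), IsRationalClass c → IsOfHodgeType n X (2 * p) p p c →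
          c ∈ motivatedClasses n X p) →
    (∀ (d : ℕ) (Z : SchemeOver ℂ) (η : complexBetti Z 2), IsSmoothProjective d Z →
      StandardConjectureBStar d Z η) →
    (∀ ⦃d : ℕ⦄ ⦃V : SchemeOver ℂ⦄, IsSmoothProjective d V → ∀ (p : ℕ)
      ⦃c : complexBetti (V ⊗ V) (2 * p)⦄, c ∈ algebraicClasses (V ⊗ V) p →
        complexBetti.map (lift (𝟙 V) (𝟙 V)) (2 * p) c ∈ algebraicClasses V p) →
    Summit.HodgeConjecture.HodgeConjecture.Theses.RankFourFaces.AbelianComplement :=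
  fun hM hB hΔ _ _ hX _ ↦ hodgeConjecture_of_motivated_of_standardConjectureB hM hB hΔ hX

/-! ## Consistency directions -/

/-- **Child 1 is a consequence of the summit**: `HodgeConjecture → HodgeAbelianVarieties` (restriction; every abelian
variety is smooth projective of dimension `A.dim`, `AbelianVariety.isSmoothProjective_holds`). In route
`RankFourFaces` the same statement is the output of the chain, `CMToAbelian (FaceReduction RankFourWeilTransport)`.
[cite: Deligne2000, §1] -/
theorem hodgeAbelianVarieties_of_hodgeConjecture (h : _root_.HodgeConjecture) :
    ∀ A : AbelianVariety ℂ, HodgeConjectureFor A.dim A.X :=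
  fun _ ↦ h AbelianVariety.isSmoothProjective_holds

/-- **Child 1 from the route's chain**: `RankFourWeilTransport → FaceReduction → CMToAbelian → HodgeAbelianVarieties`
— so once the three ranked cruxes of `RankFourFaces` close, child 1 of the split closes by this one-liner.
[cite: Andre1992HodgeCM, main theorem] -/
theorem hodgeAbelianVarieties_of_chain
    (h₂ : Summit.HodgeConjecture.HodgeConjecture.Theses.RankFourFaces.RankFourWeilTransport)
    (h₃ : Summit.HodgeConjecture.HodgeConjecture.Theses.RankFourFaces.FaceReduction)
    (h₄ : Summit.HodgeConjecture.HodgeConjecture.Theses.RankFourFaces.CMToAbelian) :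
    ∀ A : AbelianVariety ℂ, HodgeConjectureFor A.dim A.X :=
  fun A ↦ h₄ (h₃ h₂) A AbelianVariety.isSmoothProjective_holds

/-- **Child 2 holds on abelian varieties** (its content is entirely off the abelian locus, i.e. it is the typed
form of "the complement"): on `X = A.X` every deep-middle Hodge class is dominated by itself through the
identity correspondence, which is algebraic unconditionally (`isAlgebraicCorrespondence_map` for `𝟙 A.X`: the
graph = diagonal class, with the tree's discharged complex orientations and Poincaré duality).
[cite: Andre1996Motifs, §2.1 (p. 14)] [cite: VoisinHodgeII2003, §9.2.4 Prop. 9.21] -/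
theorem abelianDomination_of_abelianVariety (A : AbelianVariety ℂ) (p : ℕ) (hp : 2 * p ≤ A.dim)
    (c : complexBetti A.X (2 * p)) (hc : IsRationalClass c) (hpp : IsOfHodgeType A.dim A.X (2 * p) p p c) :
    ∃ (A' : AbelianVariety ℂ) (q : ℕ) (c' : complexBetti A'.X (2 * q))
      (T : complexBetti A'.X (2 * q) →ₗ[ℂ] complexBetti A.X (2 * p)),
      IsRationalClass c' ∧ IsOfHodgeType A'.dim A'.X (2 * q) q q c' ∧
        IsAlgebraicCorrespondence A.dim A'.dim A.X A'.X T ∧ T c' = c := by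
  refine ⟨A, p, c, (complexBetti.map (𝟙 A.X) (2 * p)).hom, hc, hpp,
    isAlgebraicCorrespondence_map AbelianVariety.isSmoothProjective_holds
      AbelianVariety.isSmoothProjective_holds (𝟙 A.X) (by omega), ?_⟩
  rw [complexBetti.map_id]
  rfl

end Summit.HodgeConjecture.HodgeConjecture.Cruxes.AbelianComplement.SplitGlue

end
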